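import Mathlib.Data.Fintype.Pi
import Mathlib.Data.Fintype.Card
import Mathlib.Algebra.BigOperators.Group.Finset.Basic
import Mathlib.Data.Real.Basic
import HarnessLib

/-!
# The arithmetic removal lemma in finite abelian groups (Green 2005)

Topic `Literature/Combinatorics/Additive`. One NAMED FACT (`def … : Prop`, never asserted):

* `Green2005_1_5` — B. Green, *A Szemerédi-type regularity lemma in abelian groups, with
  applications*, GAFA 15 (2005) 340–376, Thm. 1.5 (arXiv:math/0310476 p. 3, 'Theorem 5' of the
  arXiv render): "Let k ≥ 3 be a fixed integer, and suppose that A_1, …, A_k are subsets of G such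
  that there are o(N^{k-1}) solutions to the equation a_1 + ⋯ + a_k = 0 with a_i ∈ A_i for all i.
  Then we may remove o(N) elements from each A_i so as to leave sets A'_i, such that there are no
  solutions to a'_1 + ⋯ + a'_k = 0 with a'_i ∈ A'_i for all i."  Here G is a finite abelian group
  of order N and (ibid. p. 3, after Prop. 1.3) the o(·) notation means "there is a function
  δ' = δ'(δ) such that δ' → 0 as δ → 0" with the property that at most δN^{k-1} solutions allow the
  removal of at most δ'N elements from each set. We state the equivalent ε–δ form: for every
  k ≥ 3 and ε > 0 there is δ > 0 (depending on k and ε only — NOT on G) such that at most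
  δ·N^{k-1} zero-sum k-tuples in A_1 × ⋯ × A_k imply the existence of A'_i ⊆ A_i with
  |A_i \ A'_i| ≤ εN and no zero-sum k-tuple in A'_1 × ⋯ × A'_k.

Green's proof goes through his arithmetic regularity lemma (ibid. Thm. 5.3). For general finite
groups the same statement is Král'–Serra–Vena, *A combinatorial proof of the removal lemma for
groups*, JCTA 116 (2009), via the directed-graph removal lemma; the k = 3 abelian case also
follows from the triangle removal lemma (Mathlib `SimpleGraph.triangle_removal`,
`Mathlib.Combinatorics.SimpleGraph.Triangle.Removal`) applied to the tripartite sum graph on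
`G × Fin 3` — a discharge route, deliberately NOT taken here.

Consumers: route `MatrixMultiplication/FourierTwoFamilies` (item `DensityDecay`,
stmt-MatrixMultiplication-5963, in the regime n = O(s): under the simultaneous double product
property the equation x − y − d = 0 over ⊔A_i, ⊔B_i, ∪(A_i − B_i) has exactly Σ_i |A_i||B_i|
solutions, every same-block pair being one), and K. Pratt, arXiv:2309.03878, Cor. 2.9 (for an STPP
family one of the three packing sums is o(|G|)).

Design: `ℕ`-subtraction `k - 1` is harmless under the hypothesis `3 ≤ k`; the solution count is
the cardinality of the filter of `Fintype.piFinset A` (= A_1 × ⋯ × A_k as functions `Fin k → G`).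
-/

namespace Literature.Combinatorics.Additive

open Finset

/-- (Green 2005, Thm. 1.5: "Let `k ≥ 3` be a fixed integer, and suppose that `A_1, …, A_k` are
subsets of `G` such that there are `o(N^{k-1})` solutions to the equation `a_1 + ⋯ + a_k = 0` with
`a_i ∈ A_i` for all `i`. Then we may remove `o(N)` elements from each `A_i` so as to leave sets
`A'_i`, such that there are no solutions to `a'_1 + ⋯ + a'_k = 0` with `a'_i ∈ A'_i` for all `i`.")
**Arithmetic removal lemma in finite abelian groups**, in the ε–δ form of the paper's `o(·)`
convention (ibid. p. 3: "there is a function `δ' = δ'(δ)` such that `δ' → 0` as `δ → 0`"): for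
every `k ≥ 3` and `ε > 0` there is `δ > 0` such that for every finite abelian group `G` (order `N`)
and all `A : Fin k → Finset G`, if the number of `a ∈ ∏ᵢ A i` (`Fintype.piFinset A`) with
`∑ᵢ a i = 0` is at most `δ N^{k-1}`, then there are `A' i ⊆ A i` with `|A i \ A' i| ≤ ε N` for every
`i` and no `a' ∈ ∏ᵢ A' i` with `∑ᵢ a' i = 0`.
[cite: Green2005, Thm. 1.5] -/
def Green2005_1_5 : Prop :=
  ∀ k : ℕ, 3 ≤ k → ∀ ε : ℝ, 0 < ε → ∃ δ : ℝ, 0 < δ ∧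
    ∀ (G : Type) [AddCommGroup G] [Fintype G] [DecidableEq G] (A : Fin k → Finset G),
      ((((Fintype.piFinset A).filter fun a => ∑ i, a i = 0).card : ℕ) : ℝ) ≤
          δ * (Fintype.card G : ℝ) ^ (k - 1) →
        ∃ A' : Fin k → Finset G, (∀ i, A' i ⊆ A i) ∧
          (∀ i, (((A i \ A' i).card : ℕ) : ℝ) ≤ ε * (Fintype.card G : ℝ)) ∧
          ∀ a ∈ Fintype.piFinset A', ∑ i, a i ≠ 0

end Literature.Combinatorics.Additive
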